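import Mathlib.Algebra.Order.BigOperators.Group.Finset
import Mathlib.Analysis.SpecialFunctions.Pow.Real
import HarnessLib

/-!
# `NoHeavyLowerTail` (stmt-CriticalPhenomena-4575) — antithetic cluster pairs: the LAYER-CAKE REDUCTION for the shifted-BIC class
# (positivity of a finite bilinear form over monotone functions on a finite poset follows from its values on UP-SET INDICATORS;
# prim-hp-2 gen 66, HOME/MEMO-gen66.md §1)

Support file (`--supports stmt-CriticalPhenomena-4575`, hull-port prover `prim-hp-2`, gen 66).  No definitions, no named facts, no sorries;
standard axioms.  Purely abstract (finite sums on a finite partial order `β`).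

WHY.  The `𝒮_shift` ("shifted-BIC") hypotheses of the re-based handle machinery (…AntitheticHandleDualShift: (⊕)_shift, (M)_shift) are
positivity statements `0 ≤ Σ_a (F⁺(X_a) − F⁻(Y_a))·(G⁺(X_a) − G⁻(Y_a))` for ALL monotone `F⁻ ≤ F⁺`, `G⁻ ≤ G⁺ : Set V → ℝ`.  A nested
monotone pair `(F⁺, F⁻)` is ONE monotone function `F̂` on the poset `β = Set V × Bool` (`F̂(S, true) = F⁺ S`, `F̂(S, false) = F⁻ S`;
"BIC with a point at infinity", HOME/MEMO-gen65.md §5 (P3-pre)), and the sum is `Σ_a (F̂(p_a) − F̂(q_a))(Ĝ(p_a) − Ĝ(q_a))` with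
`p_a = (X_a, true)`, `q_a = (Y_a, false)`.  This file proves, for ANY finite poset `β` and points `p, q : ι → β`, that such a form is
nonnegative for all monotone real `F̂, Ĝ` as soon as it is nonnegative for all pairs of UP-SET INDICATORS — the finitely many extreme rays —
which is what a kernel computation can check (…AntitheticShiftDecide):
* `Antithetic.ShiftReduce.sum_mul_nonneg_of_upper` — LAYER-CAKE / DOMINANCE LEMMA: `Σ_b u_b = 0` and `Σ_{b ∈ A} u_b ≥ 0` for every up-set
  `A` imply `Σ_b u_b F(b) ≥ 0` for every monotone `F : β → ℝ` (induction on the number of points above the minimum level);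
* `Antithetic.ShiftReduce.bilinear_nonneg_of_upper` — the reduction: `Σ_{a ∈ D} (𝟙_A(p_a) − 𝟙_A(q_a))(𝟙_B(p_a) − 𝟙_B(q_a)) ≥ 0` for all
  up-sets `A, B` ⇒ `Σ_{a ∈ D} (F(p_a) − F(q_a))(G(p_a) − G(q_a)) ≥ 0` for all monotone `F, G`.
[cite: VandenbergHaggstromKahn2005, §1 p. 6 ("Harris' inequality")]
-/

noncomputable section

namespace Summit.CriticalPhenomena.PercolationContinuityZ3.Theorems

open scoped Classical

namespace Antithetic

namespace ShiftReduce

variable {β : Type*} [Fintype β] [PartialOrder β]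

/-- **Layer-cake / dominance lemma.**  On a finite poset, if `Σ_b u_b = 0` and `Σ_{b ∈ A} u_b ≥ 0` for every up-set `A`, then
`Σ_b u_b · F(b) ≥ 0` for every monotone `F : β → ℝ`. [folklore] -/
theorem sum_mul_nonneg_of_upper (u : β → ℝ) (hu0 : ∑ b, u b = 0)
    (hup : ∀ A : Finset β, (∀ x ∈ A, ∀ y, x ≤ y → y ∈ A) → 0 ≤ ∑ b ∈ A, u b)
    (F : β → ℝ) (hF : Monotone F) : 0 ≤ ∑ b, u b * F b := by
  -- induction on the number of points strictly above a lower bound `c` of `F`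
  suffices h : ∀ n : ℕ, ∀ (F : β → ℝ) (c : ℝ), Monotone F → (∀ b, c ≤ F b) →
      (Finset.univ.filter fun b => c < F b).card ≤ n → 0 ≤ ∑ b, u b * F b by
    by_cases hne : (Finset.univ : Finset β).Nonempty
    · exact h _ F (Finset.univ.inf' hne F) hF (fun b => Finset.inf'_le _ (Finset.mem_univ b)) le_rfl
    · rw [Finset.univ_eq_empty_iff.2 (not_nonempty_iff.1 fun hβ => hne Finset.univ_nonempty)]
      simp
  -- a function equal to `c` everywhere has sum `c · Σ u = 0`
  have hconst : ∀ (F : β → ℝ) (c : ℝ), (∀ b, c ≤ F b) → (Finset.univ.filter fun b => c < F b) = ∅ → 0 ≤ ∑ b, u b * F b := by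
    intro F c hc he
    have hFc : ∀ b, F b = c := fun b => by
      have hb : ¬ c < F b := fun hlt => (Finset.eq_empty_iff_forall_notMem.1 he) b (Finset.mem_filter.2 ⟨Finset.mem_univ _, hlt⟩)
      exact le_antisymm (not_lt.1 hb) (hc b)
    simp_rw [hFc, ← Finset.sum_mul, hu0, zero_mul]; exact le_rfl
  intro n
  induction n with
  | zero =>
    intro F c _ hc hcard
    exact hconst F c hc (Finset.card_eq_zero.1 (Nat.le_zero.1 hcard))
  | succ n ih =>
    intro F c hF hc hcard
    set A := Finset.univ.filter fun b => c < F b with hA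
    by_cases hAe : A = ∅
    · exact hconst F c hc hAe
    have hAne : A.Nonempty := Finset.nonempty_iff_ne_empty.2 hAe
    -- the second level `c' = F b₀` and the gap `δ = c' - c`
    obtain ⟨b₀, hb₀A, hb₀⟩ := Finset.exists_mem_eq_inf' hAne F
    have hAc' : ∀ b ∈ A, F b₀ ≤ F b := fun b hb => hb₀ ▸ Finset.inf'_le _ hb
    have hmemA : ∀ b, b ∈ A ↔ c < F b := fun b => by simp [hA]
    set c' := F b₀ with hc'
    have hδ : 0 < c' - c := by linarith [(hmemA b₀).1 hb₀A]
    -- lower the upper level by `δ`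
    let F' : β → ℝ := fun b => if c < F b then F b - (c' - c) else F b
    have hF'c : ∀ b, c ≤ F' b := fun b => by
      by_cases hb : c < F b
      · have := hAc' b ((hmemA b).2 hb); simp only [F', if_pos hb]; linarith
      · simp only [F', if_neg hb]; exact hc b
    have hF'mono : Monotone F' := by
      intro x y hxy
      by_cases hx : c < F x
      · have hy : c < F y := lt_of_lt_of_le hx (hF hxy)
        simp only [F', if_pos hx, if_pos hy]; linarith [hF hxy]
      · have hFx : F x = c := le_antisymm (not_lt.1 hx) (hc x)
        simp only [F', if_neg hx, hFx]
        exact hF'c y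
    have hcard' : (Finset.univ.filter fun b => c < F' b).card ≤ n := by
      have hsub : (Finset.univ.filter fun b => c < F' b) ⊆ A.erase b₀ := by
        intro b hb
        rw [Finset.mem_filter] at hb
        rw [Finset.mem_erase, hmemA]
        by_cases hbA : c < F b
        · refine ⟨fun hbb => ?_, hbA⟩
          subst hbb
          have : F' b = c := by simp only [F', if_pos hbA]; ring
          exact absurd hb.2 (by rw [this]; exact lt_irrefl _)
        · exact absurd hb.2 (by simp only [F', if_neg hbA]; exact hbA)
      have := Finset.card_le_card hsub
      rw [Finset.card_erase_of_mem hb₀A] at this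
      omega
    have hih := ih F' c hF'mono hF'c hcard'
    -- `F = F' + δ · 𝟙_A`
    have hsplit : ∑ b, u b * F b = ∑ b, u b * F' b + (c' - c) * ∑ b ∈ A, u b := by
      rw [hA, Finset.sum_filter, Finset.mul_sum, ← Finset.sum_add_distrib]
      refine Finset.sum_congr rfl fun b _ => ?_
      by_cases hb : c < F b
      · simp only [F', if_pos hb]; ring
      · simp only [F', if_neg hb]; ring
    have hAup : ∀ x ∈ A, ∀ y, x ≤ y → y ∈ A := fun x hx y hxy => (hmemA y).2 (lt_of_lt_of_le ((hmemA x).1 hx) (hF hxy))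
    rw [hsplit]
    exact add_nonneg hih (mul_nonneg hδ.le (hup A hAup))

omit [PartialOrder β] in
/-- Exchange of summation: a point-indexed combination of differences is a `β`-indexed sum against the signed counting weights. [folklore] -/
theorem sum_coeff_mul_eq {ι : Type*} (D : Finset ι) (p q : ι → β) (φ : ι → ℝ) (H : β → ℝ) :
    ∑ b, (∑ a ∈ D, φ a * ((if p a = b then 1 else 0) - (if q a = b then 1 else 0))) * H b = ∑ a ∈ D, φ a * (H (p a) - H (q a)) := by
  simp_rw [Finset.sum_mul]
  rw [Finset.sum_comm]
  refine Finset.sum_congr rfl fun a _ => ?_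
  have h1 : ∑ b, φ a * ((if p a = b then 1 else 0) - (if q a = b then 1 else 0)) * H b =
      ∑ b, φ a * ((if p a = b then H b else 0) - (if q a = b then H b else 0)) :=
    Finset.sum_congr rfl fun b _ => by split_ifs <;> ring
  rw [h1, ← Finset.mul_sum, Finset.sum_sub_distrib, Finset.sum_ite_eq, Finset.sum_ite_eq]
  simp

/-- **Bilinear reduction to up-set indicators.**  `D` a finite family of point pairs `(p_a, q_a)` in a finite poset `β`.  If
`Σ_{a ∈ D} (𝟙_A(p_a) − 𝟙_A(q_a))·(𝟙_B(p_a) − 𝟙_B(q_a)) ≥ 0` for all up-sets `A, B`, then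
`Σ_{a ∈ D} (F(p_a) − F(q_a))·(G(p_a) − G(q_a)) ≥ 0` for all monotone `F, G : β → ℝ`. [this work] -/
theorem bilinear_nonneg_of_upper {ι : Type*} (D : Finset ι) (p q : ι → β)
    (hcheck : ∀ A B : Finset β, (∀ x ∈ A, ∀ y, x ≤ y → y ∈ A) → (∀ x ∈ B, ∀ y, x ≤ y → y ∈ B) →
      0 ≤ ∑ a ∈ D, ((if p a ∈ A then (1 : ℝ) else 0) - (if q a ∈ A then 1 else 0)) *
        ((if p a ∈ B then (1 : ℝ) else 0) - (if q a ∈ B then 1 else 0)))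
    (F G : β → ℝ) (hF : Monotone F) (hG : Monotone G) :
    0 ≤ ∑ a ∈ D, (F (p a) - F (q a)) * (G (p a) - G (q a)) := by
  -- signed counting weights of a coefficient vector `φ`
  let w : (ι → ℝ) → β → ℝ := fun φ b => ∑ a ∈ D, φ a * ((if p a = b then 1 else 0) - (if q a = b then 1 else 0))
  have hw0 : ∀ φ, ∑ b, w φ b = 0 := fun φ => by
    have h := sum_coeff_mul_eq D p q φ (fun _ => (1 : ℝ))
    simp only [mul_one, sub_self, mul_zero, Finset.sum_const_zero] at h
    exact h
  have hwA : ∀ φ (A : Finset β), ∑ b ∈ A, w φ b = ∑ a ∈ D, φ a * ((if p a ∈ A then (1 : ℝ) else 0) - (if q a ∈ A then 1 else 0)) := by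
    intro φ A
    have h := sum_coeff_mul_eq D p q φ (fun b => if b ∈ A then (1 : ℝ) else 0)
    simp_rw [mul_boole] at h
    rw [Finset.sum_ite_mem, Finset.univ_inter] at h
    exact h
  -- step 1: one indicator, one monotone function
  have hstep : ∀ B : Finset β, (∀ x ∈ B, ∀ y, x ≤ y → y ∈ B) → ∀ F : β → ℝ, Monotone F →
      0 ≤ ∑ a ∈ D, (F (p a) - F (q a)) * ((if p a ∈ B then (1 : ℝ) else 0) - (if q a ∈ B then 1 else 0)) := by
    intro B hB F hF
    let φ : ι → ℝ := fun a => (if p a ∈ B then (1 : ℝ) else 0) - (if q a ∈ B then 1 else 0)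
    have h := sum_mul_nonneg_of_upper (w φ) (hw0 φ) (fun A hA => by
      rw [hwA]
      have := hcheck A B hA hB
      refine le_of_le_of_eq this (Finset.sum_congr rfl fun a _ => by simp only [φ]; ring)) F hF
    rw [sum_coeff_mul_eq] at h
    exact le_of_le_of_eq h (Finset.sum_congr rfl fun a _ => by simp only [φ]; ring)
  -- step 2: the second function
  let ψ : ι → ℝ := fun a => F (p a) - F (q a)
  have h := sum_mul_nonneg_of_upper (w ψ) (hw0 ψ) (fun B hB => by
    rw [hwA]
    exact le_of_le_of_eq (hstep B hB F hF) (Finset.sum_congr rfl fun a _ => by simp only [ψ])) G hG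
  rw [sum_coeff_mul_eq] at h
  exact h

end ShiftReduce

end Antithetic

end Summit.CriticalPhenomena.PercolationContinuityZ3.Theorems
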